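import Summits.QuantumFields.YangMills.Theorems.BalabanUVNodesN15KingModelFullPropagatorGradOperatorPeel

/-!
# BalabanUVNodes ∕ N15 — THE KING-MODEL RUNG, CURVED EDITION (PART Q3a): THE TRANSPOSED GRADIENT OF THE FULL `A = 0` FLUCTUATION PROPAGATOR
# AS AN OPERATOR — the kernel `∂^η_μG^η_K(y, x)` summed over its DIFFERENTIATED leg `y` against a source: the single-run level-uniform
# sup bound with decay from the support, and the operator peels ([B9] (3.42) entry `|G∇*_U λ|` at `U ≡ 1`, tools)
# (Track A, DAG node N15 = NE2; FAN-OUT v1.1 §N15 s3 «KING-MODEL RUNG …»; PART Q = NE2⁰'s OPERATOR LAYER ((3.42) sup entries) for King's full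
# propagator with genuine η-lattice test functions)

HONEST FRAMING.  Count-neutral kernel bookkeeping (cell `pub-ymgap`, seat `pub-ymgap-dag-n15-e` g7; `--supports stmt-QuantumFields-20292 --as helper`
= K3⁗ `SpineGivenEndpointR13Sep`, lineage K3 19676 → 19908 → 19912 → 20292).  TEMPLATE LITERATURE, `A = 0`: C. King's scalar U(1)-Higgs MODEL on
finite tori ([King1986] (2.13)–(2.17) p. 653, (2.20) p. 654, Theorem 3.3 (3.7) p. 658, Prop. 3.7 (3.63) p. 663, Prop. 3.8 (3.71) p. 664 second line,
§4 p. 675 (4.42)–(4.43); B4 (1.10) p. 573, (2.39) p. 582), NOT Bałaban's covariant objects; the statements are (2.17)-summed SHAPES, not printed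
propositions; NE2⁺ is NOT PRINTED for `G_k(U)∇*_U` and not proved here; NOT a node discharge; nothing continuum ∕ ℝ⁴ ∕ OS ∕ mass-gap ∕ Clay.
0 `sorry`, 0 `def`, standard axioms.

THE POINT.  [B9]'s third (3.42) entry is `|(G(U)∇*_Uλ)(x)| ≤ B₀·L^jη·e^{−δ₀d(y,y′)}|λ|`.  At `U ≡ 1`, by summation by parts on the η-lattice,
`(A₀⁻¹∇*_μλ)(x) = Σ_y η^{d+1}·L^K(G(x, y + e_μ) − G(x, y))·λ(y)`, and `G = G^η_K` is SYMMETRIC, so the kernel is `∂^η_μG^η_K(y, x)` — the gradient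
kernel of parts O-a′ ∕ O-b′ read in its SECOND slot, i.e. summed over its differentiated leg.  Its operator norm is a COLUMN sum of `|∂G|`, which
[Ba 4] (1.10) (a ROW-sum statement for `∂G`) does not print; but the peel of parts O ∕ P is symmetric in the two legs, so the same induction on the
number of levels proves it, with the ONE-level kernel bound at the bottom:
* §1 `fullPropDTOp_peel` — the single-run operator peel, transposed: summing O-a′ `fullPropD_peel` over its differentiated leg against a source on
  the `(K+1)`-level lattice costs `L^{d+1}∕L²·L·L^{−(d+1)} = L^{−1}` per level;
* §2 ★ **`fullPropDTOp_decay_unif`** — `∃ C δ > 0 ∀ K ≥ 1 ∀ N = L^K ∀ cube 2L^e ∀ 0 < m² ≤ m₀² ∀ μ ∀ f (|f| ≤ F) ∀ D ∈ ℕ ∀ x` with `f(y) = 0`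
  whenever `|B(x) − B(y)|_M < D`:  `|Σ_y N^{−(d+1)}·N·(G^η_K(y + e_μ, x) − G^η_K(y, x))·f(y)| ≤ C·e^{−δD}·F` — LEVEL-UNIFORM; induction on `K`
  (step = §1 + PART Q2a `pairOp_decay_le` on the transposed gradient piece `ksDSlice_μ(y, x)` (part M′ `ksDSlice_decay_unif`, `tdistT_symm`) +
  IH, gain `L^{−1}(C + C_sK) ≤ C`; base = the one-level kernel bound `constrainedProp_deriv_decay_blocks_unif` transposed + `pairOp_decay_le`);
* §3 `fullPropDTOp_peel_pair` — the transposed operator peel of the PAIR (O-b′ `fullPropD_peel_fine` + O-a′ `fullPropD_peel` at swapped legs,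
  per-level factor `L^{−1}`), the tool of the paired rate (PART Q3b `…GradTransposeRate`).
WHAT THE CURVED CASE ADDS (one line): Bałaban's `G_k(U)∇*_U λ` uniformly over the live window `Reg335` (random-walk expansion, B9 Sect. C);
print gives analyticity in `U` and η-uniformity, never an η-difference.
HONEST SCOPE.  (i) `A = 0`, periodic b.c., odd `L ≥ 3`, `0 < m² ≤ m₀²`, cubes `2L^e`, `K ≥ 1`; (ii) lattice units of level `K` for the kernel, fine
measure `N^{−(d+1)}` for the sum; (iii) the identification with `A₀⁻¹∇*` (symmetry of `G^η_K`) is read out downstream, not here; (iv) block-distance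
currency; not Bałaban's `G_k(U)∇*_U`; not a discharge.
Locators: [King1986] C. King, CMP **102** (1986) 649–677: (2.13)–(2.17) p. 653, (2.20) p. 654, Theorem 3.3 (3.7) p. 658, Prop. 3.7 (3.63) p. 663,
Prop. 3.8 (3.71) p. 664, (4.42)–(4.43) p. 675; [Ba 4] = [Balaban1983RegularityDecay] Theorem (1.10) p. 573, (2.39) p. 582; [B9] =
[Balaban1985BackgroundPropagators] Thm 3.1 (3.42) p. 397 + Thm 3.14 pp. 426–427 (typing template).
-/

noncomputable section

namespace Summit.QuantumFields.YangMills.BalabanUVNodes.N15KingModelRung.Curved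

open Real Finset Matrix
open Literature.MathematicalPhysics.QuantumFieldTheory.Balaban1983to89 (Params)
open Literature.MathematicalPhysics.QuantumFieldTheory.Balaban1983to89.B4Sect5Proof (latticeConst latticeConst_nonneg)
open Literature.MathematicalPhysics.QuantumFieldTheory.Balaban1983to89.B5Prop11Plancherel (Tor fine unitVec)
open Literature.MathematicalPhysics.QuantumFieldTheory.King1986 (aK aK_pos)
open Literature.MathematicalPhysics.QuantumFieldTheory.King1986.Torus (constrainedProp flatten blockOf tdistT torCongr
  blockOf_flatten tdistT_nonneg tdistT_symm constrainedProp_deriv_decay_blocks_unif)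

variable {d : ℕ} (L : ℕ) [NeZero L]

/-! ## §1 The single-run operator peel, transposed -/

/-- **THE SINGLE-RUN OPERATOR PEEL, TRANSPOSED**: for the slice index `i = (e, K = i.j, …)`, `a > 0`, `m² > 0`, `L ≥ 2`, direction `μ`, a source `f̂`
on the `(K+1)`-level lattice over the cube `M_e` and a point `x` one level down,
`Σ_ŷ (L^KL)^{−(d+1)}·[L^KL·(G(K+1)(ŷ + e_μ, flatten x) − G(K+1)(ŷ, flatten x))]·f̂(ŷ)
 = L^{−1}·Σ_y (L^K)^{−(d+1)}·[L^K·(G(K)^{sub}(y + e_μ, x) − G(K)^{sub}(y, x)) + ksDSlice_μ(y, x)]·f̂(flatten y)`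
(mass `m²` upstairs, `m²∕L²` downstairs; O-a′ `fullPropD_peel` at the legs `(y, x)`, summed along `flatten`).
[cite: King1986, (2.17) p.653, (2.20) p.654, Prop. 3.8 (3.71) p.664 (second line, object), (4.42) p.675; Balaban1983RegularityDecay, (2.39) p.582] -/
theorem fullPropDTOp_peel (hL : 2 ≤ L) {a msq : ℝ} (ha : 0 < a) (hm : 0 < msq) (i : KSliceIdx d) (μ : Fin (d + 1))
    (f : Tor (fine (L ^ i.j * L) (ksM L i)) → ℝ) (x : Tor (fine (L ^ i.j) (ksU L i))) :
    ∑ y' : Tor (fine (L ^ i.j * L) (ksM L i)),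
        ((((L ^ i.j * L : ℕ) : ℝ) ^ (d + 1))⁻¹ *
          (((L ^ i.j * L : ℕ) : ℝ) *
            (constrainedProp (L ^ i.j * L) (ksM L i) (aK a L (i.j + 1)) (((L ^ i.j * L : ℕ) : ℝ) ^ 2) msq
                (y' + unitVec (fine (L ^ i.j * L) (ksM L i)) μ) (flatten (L ^ i.j) L (ksM L i) x)
              - constrainedProp (L ^ i.j * L) (ksM L i) (aK a L (i.j + 1)) (((L ^ i.j * L : ℕ) : ℝ) ^ 2) msq
                y' (flatten (L ^ i.j) L (ksM L i) x)))
          * f y')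
      = ((L : ℝ))⁻¹ *
        ∑ y : Tor (fine (L ^ i.j) (ksU L i)),
          ((((L ^ i.j : ℕ) : ℝ) ^ (d + 1))⁻¹ *
            (((L ^ i.j : ℕ) : ℝ) *
                (constrainedProp (L ^ i.j) (ksU L i) (aK a L i.j) (((L ^ i.j : ℕ) : ℝ) ^ 2) (msq / (L : ℝ) ^ 2)
                    (y + unitVec (fine (L ^ i.j) (ksU L i)) μ) x
                  - constrainedProp (L ^ i.j) (ksU L i) (aK a L i.j) (((L ^ i.j : ℕ) : ℝ) ^ 2) (msq / (L : ℝ) ^ 2) y x)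
              + ksDSlice L a (msq / (L : ℝ) ^ 2) i μ y x)
            * f (flatten (L ^ i.j) L (ksM L i) y)) := by
  have hL0 : (0 : ℝ) < L := by exact_mod_cast (show 0 < L by omega)
  have hLne : (L : ℝ) ≠ 0 := hL0.ne'
  rw [← (flatten (L ^ i.j) L (ksM L i)).sum_comp]
  rw [Finset.mul_sum]
  refine Finset.sum_congr rfl fun y _ => ?_
  rw [fullPropD_peel L hL ha hm i μ y x]
  have hcast : (((L ^ i.j * L : ℕ) : ℝ)) = ((L ^ i.j : ℕ) : ℝ) * L := by push_cast; ring
  rw [hcast]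
  have hNK : (((L ^ i.j : ℕ) : ℝ)) ≠ 0 := by positivity
  field_simp
  ring

/-! ## §2 The transposed gradient as an operator: level-uniform sup bound with decay from the support -/

/-- **THE TRANSPOSED GRADIENT OF KING'S FULL `A = 0` FLUCTUATION PROPAGATOR AS AN OPERATOR, LEVEL-UNIFORM, WITH DECAY FROM THE SUPPORT**
(the column-sum twin of [Ba 4] (1.10) clause 2 ∕ Theorem 3.3 (3.7); the (2.17)-summed SHAPE, not printed): for odd `L ≥ 3`, `a > 0` and a mass cap
`m₀² ≥ 0` there are `C, δ > 0` (functions of `d, L, a, m₀²`) such that for EVERY `K ≥ 1`, any spelling `N = L^K`, cube `M_μ = 2L^e`, mass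
`0 < m² ≤ m₀²`, direction `μ`, source `f` with `|f| ≤ F`, every `D ∈ ℕ` and fine point `x` such that `f(y) = 0` whenever `|B(x) − B(y)|_M < D`:
`|Σ_y N^{−(d+1)}·N·(G^η_K(y + e_μ, x) − G^η_K(y, x))·f(y)| ≤ C·e^{−δD}·F`.  Induction on `K` (module docstring).
[cite: King1986, (2.13)–(2.17) p.653, (2.20) p.654, Theorem 3.3 (3.7) p.658, Prop. 3.7 (3.63) p.663, (4.42)–(4.44) p.675; Balaban1983RegularityDecay, Theorem (1.10) p.573, (2.39) p.582] -/
theorem fullPropDTOp_decay_unif (hLodd : Odd L) (hL : 2 ≤ L) {a : ℝ} (ha : 0 < a) {m0sq : ℝ} (hm0 : 0 ≤ m0sq) :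
    ∃ C δ : ℝ, 0 < C ∧ 0 < δ ∧ ∀ (K : ℕ), 1 ≤ K → ∀ (N : ℕ) [NeZero N], N = L ^ K →
      ∀ (e : ℕ) (M : Fin (d + 1) → ℕ) [∀ μ, NeZero (M μ)], (∀ μ, M μ = 2 * L ^ e) →
      ∀ (msq : ℝ), 0 < msq → msq ≤ m0sq → ∀ (μ : Fin (d + 1))
      (f : Tor (fine N M) → ℝ) (F : ℝ), (∀ y, |f y| ≤ F) → ∀ (D : ℕ) (x : Tor (fine N M)),
        (∀ y, f y ≠ 0 → (D : ℝ) ≤ tdistT M (blockOf N M x) (blockOf N M y)) →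
        |∑ y, ((((N : ℕ) : ℝ) ^ (d + 1))⁻¹ *
            ((N : ℝ) * (constrainedProp N M (aK a L K) (((N : ℕ) : ℝ) ^ 2) msq (y + unitVec (fine N M) μ) x
              - constrainedProp N M (aK a L K) (((N : ℕ) : ℝ) ^ 2) msq y x))
            * f y)|
          ≤ C * Real.exp (-(δ * D)) * F := by
  have hL1 : 1 < L := by omega
  have hL1' : (1 : ℝ) ≤ L := by exact_mod_cast hL1.le
  have hL0 : (0 : ℝ) < L := by positivity
  have hLne : (L : ℝ) ≠ 0 := hL0.ne'
  have hLm1 : (1 : ℝ) ≤ (L : ℝ) - 1 := by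
    have : (2 : ℝ) ≤ L := by exact_mod_cast hL
    linarith
  obtain ⟨δb, cb, hδb, hcb, Hb⟩ := constrainedProp_deriv_decay_blocks_unif (d + 1) L (by omega) ⟨hLodd, hL1⟩ ha hm0
  obtain ⟨Cs, κ, hCs, hκ, Hs⟩ := ksDSlice_decay_unif (d := d) L hLodd hL ha hm0
  have hKb := latticeConst_nonneg (d + 1) (half_pos hδb).le
  have hKs := latticeConst_nonneg (d + 1) (half_pos hκ).le
  set δ : ℝ := min (δb / 2) (κ / 2) with hδdef
  have hδ : 0 < δ := lt_min (half_pos hδb) (half_pos hκ)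
  have hδb' : δ ≤ δb / 2 := min_le_left _ _
  have hδκ : δ ≤ κ / 2 := min_le_right _ _
  set B₁ : ℝ := (L : ℝ) ^ (d + 1) * cb * latticeConst (d + 1) (δb / 2) with hB₁
  have hB₁0 : 0 ≤ B₁ := by positivity
  set R : ℝ := Cs * latticeConst (d + 1) (κ / 2) with hRdef
  have hR0 : 0 ≤ R := by positivity
  set C : ℝ := B₁ + R + 1 with hCdef
  have hC : 0 < C := by positivity
  have hCB : B₁ ≤ C := by rw [hCdef]; linarith
  have hCR : R ≤ C := by rw [hCdef]; linarith
  have hEmono : ∀ {r : ℝ} {D : ℕ}, δ ≤ r → Real.exp (-(r * D)) ≤ Real.exp (-(δ * D)) := fun hr =>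
    Real.exp_le_exp.mpr (neg_le_neg (mul_le_mul_of_nonneg_right hr (Nat.cast_nonneg _)))
  refine ⟨C, δ, hC, hδ, ?_⟩
  intro K hK
  induction K, hK using Nat.le_induction with
  | base =>
    intro N _ hN e M _ hM msq hmsq hcap μ f F hF D x hsupp
    subst hN
    have hF0 : 0 ≤ F := (abs_nonneg _).trans (hF x)
    set E : ℝ := Real.exp (-(δ * D)) with hEdef
    set P : Params := ⟨d + 1, L, e, 1, by omega, ⟨hLodd, hL1⟩⟩ with hP
    have hMK : ∀ μ, M μ = P.sitesPerDir P.K := fun μ => by rw [hM μ]; simp [hP, Params.sitesPerDir]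
    set G₁ := constrainedProp (L ^ 1) M (aK a L 1) (((L ^ 1 : ℕ) : ℝ) ^ 2) msq with hG₁def
    -- the one-level derivative kernel, transposed: the letter is symmetric in the two blocks
    have hk : ∀ y, |(((L ^ 1 : ℕ) : ℝ)) * (G₁ (y + unitVec (fine (L ^ 1) M) μ) x - G₁ y x)|
        ≤ (L : ℝ) ^ (d + 1) * cb * Real.exp (-(δb * tdistT M (blockOf (L ^ 1) M x) (blockOf (L ^ 1) M y))) := by
      intro y
      have h1 := Hb P rfl rfl le_rfl msq hmsq.le hcap M hMK (L ^ 1) rfl y x μ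
      have hcast : (((L ^ 1 : ℕ) : ℝ)) ^ P.d * cb = (L : ℝ) ^ (d + 1) * cb := by simp [hP]
      rw [hcast, tdistT_symm] at h1
      exact h1
    have h := pairOp_decay_le (L ^ 1) M hδb (by positivity)
      (fun x' y => (((L ^ 1 : ℕ) : ℝ)) * (G₁ (y + unitVec (fine (L ^ 1) M) μ) x' - G₁ y x')) x hk f hF hsupp
    calc |∑ y, ((((L ^ 1 : ℕ) : ℝ) ^ (d + 1))⁻¹ * ((((L ^ 1 : ℕ) : ℝ)) * (G₁ (y + unitVec (fine (L ^ 1) M) μ) x - G₁ y x)) * f y)|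
        ≤ (L : ℝ) ^ (d + 1) * cb * latticeConst (d + 1) (δb / 2) * Real.exp (-(δb / 2 * D)) * F := h
      _ ≤ B₁ * E * F := mul_le_mul_of_nonneg_right (mul_le_mul_of_nonneg_left (hEmono hδb') hB₁0) hF0
      _ ≤ C * E * F := by gcongr
  | succ K hK IH =>
    intro N _ hN e M _ hM msq hmsq hcap μ f F hF D x' hsupp0
    subst hN
    have hF0 : 0 ≤ F := (abs_nonneg _).trans (hF x')
    obtain rfl : M = fun _ => 2 * L ^ e := funext hM
    set i : KSliceIdx d := ⟨e, K, hK, 1, le_rfl, 0, Nat.zero_le e, 1, le_rfl⟩ with hidef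
    obtain ⟨x, rfl⟩ := (flatten (L ^ K) L (ksM L i)).surjective x'
    set E : ℝ := Real.exp (-(δ * D)) with hEdef
    have hE0 : 0 < E := Real.exp_pos _
    have hgF : ∀ y : Tor (fine (L ^ K) (ksU L i)), |(fun y => f (flatten (L ^ K) L (ksM L i) y)) y| ≤ F := fun y => hF _
    have hL2 : (0 : ℝ) < (L : ℝ) ^ 2 := by positivity
    have hm2 : 0 < msq / (L : ℝ) ^ 2 := div_pos hmsq hL2
    have hm2cap : msq / (L : ℝ) ^ 2 ≤ m0sq := by
      have h1 : (1 : ℝ) ≤ (L : ℝ) ^ 2 := one_le_pow₀ hL1'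
      exact (div_le_self hmsq.le h1).trans hcap
    have hM' : ∀ μ, ksU L i μ = 2 * L ^ (e + 1) := fun μ => by
      show L * (2 * L ^ e) = 2 * L ^ (e + 1)
      ring
    -- the support condition one level down: block distances only grow under the peel
    have hsupp : ∀ y : Tor (fine (L ^ K) (ksU L i)), (fun y => f (flatten (L ^ K) L (ksM L i) y)) y ≠ 0 →
        (D : ℝ) ≤ tdistT (ksU L i) (blockOf (L ^ K) (ksU L i) x) (blockOf (L ^ K) (ksU L i) y) := by
      intro y hy
      have h0 := hsupp0 (flatten (L ^ K) L (ksM L i) y) hy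
      have hBx : blockOf (L ^ (K + 1)) (fun _ : Fin (d + 1) => 2 * L ^ e) (flatten (L ^ K) L (ksM L i) x)
          = blockOf L (ksM L i) (blockOf (L ^ K) (ksU L i) x) := blockOf_flatten (L ^ K) L (ksM L i) x
      have hBy : blockOf (L ^ (K + 1)) (fun _ : Fin (d + 1) => 2 * L ^ e) (flatten (L ^ K) L (ksM L i) y)
          = blockOf L (ksM L i) (blockOf (L ^ K) (ksU L i) y) := blockOf_flatten (L ^ K) L (ksM L i) y
      rw [hBx, hBy] at h0
      have hgrow := mul_tdistT_blockOf_le L (ksM L i) (blockOf (L ^ K) (ksU L i) x) (blockOf (L ^ K) (ksU L i) y)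
      have hsub0 := tdistT_nonneg (ksU L i) (blockOf (L ^ K) (ksU L i) x) (blockOf (L ^ K) (ksU L i) y)
      rcases Nat.eq_zero_or_pos D with hD0 | hDpos
      · rw [hD0, Nat.cast_zero]; exact hsub0
      · have hD1 : (1 : ℝ) ≤ D := by exact_mod_cast hDpos
        have hprod : 0 ≤ ((L : ℝ) - 1) * ((D : ℝ) - 1) := mul_nonneg (by linarith) (by linarith)
        nlinarith
    have hpeel := fullPropDTOp_peel L hL ha hmsq i μ f x
    set w : ℝ := ((((L ^ K : ℕ) : ℝ)) ^ (d + 1))⁻¹ with hw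
    set Gs := constrainedProp (L ^ K) (ksU L i) (aK a L K) (((L ^ K : ℕ) : ℝ) ^ 2) (msq / (L : ℝ) ^ 2) with hGs
    have hIH : |∑ y, w * ((((L ^ K : ℕ) : ℝ)) * (Gs (y + unitVec (fine (L ^ K) (ksU L i)) μ) x - Gs y x))
            * f (flatten (L ^ K) L (ksM L i) y)| ≤ C * E * F :=
      IH (L ^ K) rfl (e + 1) (ksU L i) hM' (msq / (L : ℝ) ^ 2) hm2 hm2cap μ _ F hgF D x hsupp
    -- the transposed gradient piece: letter at swapped legs, symmetric in the blocks
    have hS0 : |∑ y, w * ksDSlice L a (msq / (L : ℝ) ^ 2) i μ y x * f (flatten (L ^ K) L (ksM L i) y)|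
          ≤ Cs * latticeConst (d + 1) (κ / 2) * Real.exp (-(κ / 2 * D)) * F := by
      have hk : ∀ y, |ksDSlice L a (msq / (L : ℝ) ^ 2) i μ y x|
          ≤ Cs * Real.exp (-(κ * tdistT (ksU L i) (blockOf (L ^ K) (ksU L i) x) (blockOf (L ^ K) (ksU L i) y))) := by
        intro y
        have h1 := (Hs (msq / (L : ℝ) ^ 2) hm2 hm2cap i μ).1 y x
        rw [tdistT_symm] at h1
        exact h1
      exact pairOp_decay_le (L ^ K) (ksU L i) hκ hCs.le (fun x'' y => ksDSlice L a (msq / (L : ℝ) ^ 2) i μ y x'') x hk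
        (fun y => f (flatten (L ^ K) L (ksM L i) y)) hgF hsupp
    have hS : |∑ y, w * ksDSlice L a (msq / (L : ℝ) ^ 2) i μ y x * f (flatten (L ^ K) L (ksM L i) y)| ≤ R * E * F :=
      hS0.trans (mul_le_mul_of_nonneg_right (mul_le_mul_of_nonneg_left (hEmono hδκ) hR0) hF0)
    have hsum : ∑ y, w * ((((L ^ K : ℕ) : ℝ)) * (Gs (y + unitVec (fine (L ^ K) (ksU L i)) μ) x - Gs y x)
            + ksDSlice L a (msq / (L : ℝ) ^ 2) i μ y x) * f (flatten (L ^ K) L (ksM L i) y)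
        = ∑ y, w * ((((L ^ K : ℕ) : ℝ)) * (Gs (y + unitVec (fine (L ^ K) (ksU L i)) μ) x - Gs y x))
            * f (flatten (L ^ K) L (ksM L i) y)
          + ∑ y, w * ksDSlice L a (msq / (L : ℝ) ^ 2) i μ y x * f (flatten (L ^ K) L (ksM L i) y) := by
      rw [← Finset.sum_add_distrib]
      exact Finset.sum_congr rfl fun y _ => by ring
    -- the gain: `L^{−1}·(C + R) ≤ C` because `R ≤ C ≤ (L − 1)·C`
    have hgain : ((L : ℝ))⁻¹ * (C * E * F + R * E * F) ≤ C * E * F := by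
      have hq : 0 ≤ E * F := by positivity
      have h1 : C * E * F + R * E * F = (C + R) * (E * F) := by ring
      have h2 : C * E * F = C * (E * F) := by ring
      rw [h1, h2, ← mul_assoc]
      refine mul_le_mul_of_nonneg_right ?_ hq
      rw [inv_mul_le_iff₀ hL0]
      nlinarith
    have hLi : (0 : ℝ) ≤ ((L : ℝ))⁻¹ := by positivity
    calc |∑ y' : Tor (fine (L ^ K * L) (ksM L i)),
            ((((L ^ K * L : ℕ) : ℝ) ^ (d + 1))⁻¹ *
              (((L ^ K * L : ℕ) : ℝ) *
                (constrainedProp (L ^ K * L) (ksM L i) (aK a L (K + 1)) (((L ^ K * L : ℕ) : ℝ) ^ 2) msq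
                    (y' + unitVec (fine (L ^ K * L) (ksM L i)) μ) (flatten (L ^ K) L (ksM L i) x)
                  - constrainedProp (L ^ K * L) (ksM L i) (aK a L (K + 1)) (((L ^ K * L : ℕ) : ℝ) ^ 2) msq
                    y' (flatten (L ^ K) L (ksM L i) x)))
              * f y')|
        = ((L : ℝ))⁻¹ *
          |∑ y, w * ((((L ^ K : ℕ) : ℝ)) * (Gs (y + unitVec (fine (L ^ K) (ksU L i)) μ) x - Gs y x))
              * f (flatten (L ^ K) L (ksM L i) y)
            + ∑ y, w * ksDSlice L a (msq / (L : ℝ) ^ 2) i μ y x * f (flatten (L ^ K) L (ksM L i) y)| := by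
          rw [hpeel, hsum, abs_mul, abs_of_nonneg hLi]
      _ ≤ ((L : ℝ))⁻¹ * (C * E * F + R * E * F) :=
          mul_le_mul_of_nonneg_left ((abs_add_le _ _).trans (add_le_add hIH hS)) hLi
      _ ≤ C * E * F := hgain

/-! ## §3 The transposed operator peel of the pair -/

/-- **THE TRANSPOSED OPERATOR PEEL OF THE PAIR**: for the slice index `i = (e, K = i.j, n = i.n, …)`, `a > 0`, `m² > 0`, `L ≥ 2`, direction `μ`, the
spelling bridge `h`, a source `f̂′` on the `(K+1+n)`-level fine lattice over the cube `M_e` and a fine point `x′` of the nested torus (the coarse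
observation point written `flatten (u x′)` = `û ê x̂′` by part O-b `underPtN_flatten`):
`Σ_{ŷ′}(L^nL^{K+1})^{−(d+1)}[L^nL^{K+1}·(G(K+1+n)(ŷ′ + e_μ, ê x̂′) − G(K+1+n)(ŷ′, ê x̂′)) − L^{K+1}·(G(K+1)(û ŷ′ + e_μ, û ê x̂′) − G(K+1)(û ŷ′, û ê x̂′))]·f̂′(ŷ′)
 = L^{−1}·Σ_{y′}(L^nL^K)^{−(d+1)}{[transposed gradient pair one level down, mass m²∕L²] + [ksDSlice′_μ(y′, x′) − ksDSlice_μ(u y′, u x′)]}·f̂′(ê(flatten y′))`.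
[cite: King1986, (2.17) p.653, (2.20) p.654, Prop. 3.8 (3.71) p.664 (second line, object), (4.42) p.675; Balaban1983RegularityDecay, (2.39) p.582] -/
theorem fullPropDTOp_peel_pair (hL : 2 ≤ L) {a msq : ℝ} (ha : 0 < a) (hm : 0 < msq) (i : KSliceIdx d) (μ : Fin (d + 1))
    (h : ∀ ν, fine (L ^ i.n * L ^ i.j * L) (ksM L i) ν = fine (L ^ i.n * L ^ (i.j + 1)) (ksM L i) ν)
    (f' : Tor (fine (L ^ i.n * L ^ (i.j + 1)) (ksM L i)) → ℝ) (x' : Tor (fine (L ^ i.n * L ^ i.j) (ksU L i))) :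
    ∑ y'' : Tor (fine (L ^ i.n * L ^ (i.j + 1)) (ksM L i)),
        ((((L ^ i.n * L ^ (i.j + 1) : ℕ) : ℝ) ^ (d + 1))⁻¹ *
          (((L ^ i.n * L ^ (i.j + 1) : ℕ) : ℝ) *
              (constrainedProp (L ^ i.n * L ^ (i.j + 1)) (ksM L i) (aK a L (i.j + 1 + i.n))
                  (((L ^ i.n * L ^ (i.j + 1) : ℕ) : ℝ) ^ 2) msq
                  (y'' + unitVec (fine (L ^ i.n * L ^ (i.j + 1)) (ksM L i)) μ) (torCongr h (flatten (L ^ i.n * L ^ i.j) L (ksM L i) x'))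
                - constrainedProp (L ^ i.n * L ^ (i.j + 1)) (ksM L i) (aK a L (i.j + 1 + i.n))
                  (((L ^ i.n * L ^ (i.j + 1) : ℕ) : ℝ) ^ 2) msq
                  y'' (torCongr h (flatten (L ^ i.n * L ^ i.j) L (ksM L i) x')))
            - ((L ^ (i.j + 1) : ℕ) : ℝ) *
              (constrainedProp (L ^ (i.j + 1)) (ksM L i) (aK a L (i.j + 1)) (((L ^ (i.j + 1) : ℕ) : ℝ) ^ 2) msq
                  (underPtN L (i.j + 1) i.n (ksM L i) y'' + unitVec (fine (L ^ (i.j + 1)) (ksM L i)) μ)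
                  (flatten (L ^ i.j) L (ksM L i) (underPtN L i.j i.n (ksU L i) x'))
                - constrainedProp (L ^ (i.j + 1)) (ksM L i) (aK a L (i.j + 1)) (((L ^ (i.j + 1) : ℕ) : ℝ) ^ 2) msq
                  (underPtN L (i.j + 1) i.n (ksM L i) y'')
                  (flatten (L ^ i.j) L (ksM L i) (underPtN L i.j i.n (ksU L i) x'))))
          * f' y'')
      = ((L : ℝ))⁻¹ *
        ∑ y' : Tor (fine (L ^ i.n * L ^ i.j) (ksU L i)),
          ((((L ^ i.n * L ^ i.j : ℕ) : ℝ) ^ (d + 1))⁻¹ *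
            ((((L ^ i.n * L ^ i.j : ℕ) : ℝ) *
                  (constrainedProp (L ^ i.n * L ^ i.j) (ksU L i) (aK a L (i.j + i.n)) (((L ^ i.n * L ^ i.j : ℕ) : ℝ) ^ 2)
                      (msq / (L : ℝ) ^ 2) (y' + unitVec (fine (L ^ i.n * L ^ i.j) (ksU L i)) μ) x'
                    - constrainedProp (L ^ i.n * L ^ i.j) (ksU L i) (aK a L (i.j + i.n)) (((L ^ i.n * L ^ i.j : ℕ) : ℝ) ^ 2)
                      (msq / (L : ℝ) ^ 2) y' x')
                - ((L ^ i.j : ℕ) : ℝ) *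
                  (constrainedProp (L ^ i.j) (ksU L i) (aK a L i.j) (((L ^ i.j : ℕ) : ℝ) ^ 2) (msq / (L : ℝ) ^ 2)
                      (underPtN L i.j i.n (ksU L i) y' + unitVec (fine (L ^ i.j) (ksU L i)) μ) (underPtN L i.j i.n (ksU L i) x')
                    - constrainedProp (L ^ i.j) (ksU L i) (aK a L i.j) (((L ^ i.j : ℕ) : ℝ) ^ 2) (msq / (L : ℝ) ^ 2)
                      (underPtN L i.j i.n (ksU L i) y') (underPtN L i.j i.n (ksU L i) x')))
              + (ksDSlice' L a (msq / (L : ℝ) ^ 2) i μ y' x'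
                - ksDSlice L a (msq / (L : ℝ) ^ 2) i μ (underPtN L i.j i.n (ksU L i) y') (underPtN L i.j i.n (ksU L i) x')))
            * f' (torCongr h (flatten (L ^ i.n * L ^ i.j) L (ksM L i) y'))) := by
  have hL0 : (0 : ℝ) < L := by exact_mod_cast (show 0 < L by omega)
  have hLne : (L : ℝ) ≠ 0 := hL0.ne'
  -- re-index the fine sum along `flatten ≫ torCongr`
  rw [← ((flatten (L ^ i.n * L ^ i.j) L (ksM L i)).trans (torCongr h)).sum_comp]
  simp only [Equiv.trans_apply]
  rw [Finset.mul_sum]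
  refine Finset.sum_congr rfl fun y' _ => ?_
  -- the coarse peel at the legs `(u y′, u x′)`, in the successor spelling of the statement
  have hP : ((L ^ (i.j + 1) : ℕ) : ℝ) *
        (constrainedProp (L ^ (i.j + 1)) (ksM L i) (aK a L (i.j + 1)) (((L ^ (i.j + 1) : ℕ) : ℝ) ^ 2) msq
            (underPtN L (i.j + 1) i.n (ksM L i) (torCongr h (flatten (L ^ i.n * L ^ i.j) L (ksM L i) y'))
              + unitVec (fine (L ^ (i.j + 1)) (ksM L i)) μ)
            (flatten (L ^ i.j) L (ksM L i) (underPtN L i.j i.n (ksU L i) x'))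
          - constrainedProp (L ^ (i.j + 1)) (ksM L i) (aK a L (i.j + 1)) (((L ^ (i.j + 1) : ℕ) : ℝ) ^ 2) msq
            (underPtN L (i.j + 1) i.n (ksM L i) (torCongr h (flatten (L ^ i.n * L ^ i.j) L (ksM L i) y')))
            (flatten (L ^ i.j) L (ksM L i) (underPtN L i.j i.n (ksU L i) x')))
      = (L : ℝ) ^ (d + 1) / (L : ℝ) ^ 2 * L *
          (((L ^ i.j : ℕ) : ℝ) *
              (constrainedProp (L ^ i.j) (ksU L i) (aK a L i.j) (((L ^ i.j : ℕ) : ℝ) ^ 2) (msq / (L : ℝ) ^ 2)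
                  (underPtN L i.j i.n (ksU L i) y' + unitVec (fine (L ^ i.j) (ksU L i)) μ) (underPtN L i.j i.n (ksU L i) x')
                - constrainedProp (L ^ i.j) (ksU L i) (aK a L i.j) (((L ^ i.j : ℕ) : ℝ) ^ 2) (msq / (L : ℝ) ^ 2)
                  (underPtN L i.j i.n (ksU L i) y') (underPtN L i.j i.n (ksU L i) x'))
            + ksDSlice L a (msq / (L : ℝ) ^ 2) i μ (underPtN L i.j i.n (ksU L i) y') (underPtN L i.j i.n (ksU L i) x')) := by
    rw [underPtN_flatten L i.j i.n (ksM L i) h y']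
    exact fullPropD_peel L hL ha hm i μ _ _
  rw [hP, fullPropD_peel_fine L hL ha hm i μ y' x' h]
  have hcast : (((L ^ i.n * L ^ (i.j + 1) : ℕ) : ℝ)) = ((L ^ i.n * L ^ i.j : ℕ) : ℝ) * L := by push_cast; ring
  rw [hcast]
  have hNK : (((L ^ i.n * L ^ i.j : ℕ) : ℝ)) ≠ 0 := by positivity
  field_simp
  ring

end Summit.QuantumFields.YangMills.BalabanUVNodes.N15KingModelRung.Curved
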